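import Literature.AnabelianGeometry.EtaleTheta.SettingModelHeisenberg
import Mathlib.GroupTheory.QuotientGroup.Basic
import Mathlib.Tactic.Group
import HarnessLib

/-!
# A model of the [EtTh] §1 root — the class-two presentation: `Ker(F₂ ↠ Heis ℤ) = [[F₂,F₂],F₂]`

Mochizuki, *The étale theta function …*, Publ. RIMS **45** (2009) [EtTh], §1, PRIMS PDF p. 12
[cite: MochizukiEtTh2009, §1 p.12]: "`Δ^Θ_X := Δ_X/[Δ_X, [Δ_X, Δ_X]]`", "`Δ_Θ` (`≅ Ẑ(1)`) … the image of
`∧² Δ^ell_X` in `Δ^Θ_X`". Layer L2 of the abc-iut cell (seat abc-iut-L6-d6 gen 4; abc-iut-L2-lead gen 3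
ROW #5 = R78/R85 «χ-twisted root model», SHAPES item (a5)). PROOF-ONLY companion of abc-iut-L2-t1's
`SettingModelHeisenberg.lean` (`Heis R`, `heisHom : F₂ ↠ Heis ℤ`, `Heis.commutator_commutator_le_ker`).

The root model files use the discrete class-2 shadow `heisHom : F₂ ↠ Heis ℤ` (`a ↦ (1,0,0)`,
`b ↦ (0,1,0)`) of the theta quotient and prove ONE inclusion, `[[F₂,F₂],F₂] ≤ Ker heisHom`
(`Heis.commutator_commutator_le_ker`). This file proves the converse, i.e. the classical presentation of the
integral Heisenberg group as the FREE NILPOTENT GROUP OF CLASS TWO on two generators: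

* class-two calculus in a group all of whose commutators are central (`⁅g·g', h⁆ = ⁅g,h⁆·⁅g',h⁆`,
  `⁅g^m, h^n⁆ = ⁅g,h⁆^(m·n)` for `m, n ∈ ℤ`);
* `Heis.exists_hom_of_commutator_central` — the universal property of `Heis ℤ` among such groups: for
  `a, b ∈ G` there is a homomorphism `Heis ℤ → G` with `(1,0,0) ↦ a`, `(0,1,0) ↦ b`
  (`(x,y,z) ↦ a^x b^y ⁅a,b⁆^(z−xy)`);
* **`ker_heisHom_eq_commutator_commutator : heisHom.ker = ⁅⁅⊤, ⊤⁆, ⊤⁆`**, equivalently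
  `F₂/[[F₂,F₂],F₂] ≃ Heis ℤ` (`heisHom` surjective, `heisHom_surjective`) — so the kernel of the model's
  discrete theta quotient IS the printed `[Δ_X,[Δ_X,Δ_X]]` at the discrete level, and (by density, sequel)
  the profinite theta-quotient kernel `[[Δ_X,Δ_X],Δ_X]⁻ ⊆ F̂₂` is the joint kernel of the level maps
  `F̂₂ → Heis (ℤ/N)`, whence `Δ_Θ ≅ Ẑ` in the finer/twisted root models.

Classical group theory ([folklore]; e.g. M. Hall, *The Theory of Groups*, §10–11, basic commutators of
weight ≤ 2); nothing of [EtTh] is asserted; a model is consistency evidence only; no side is taken on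
[IUTchIII] Cor. 3.12. No definitions, no instances, no Prop facts.
-/

namespace Literature.AnabelianGeometry.EtaleTheta.SettingModel

open scoped commutatorElement

/-! ### Class-two commutator calculus -/

section ClassTwo

variable {G : Type*} [Group G]

/-- `⁅g·g', h⁆ = (g ⁅g', h⁆ g⁻¹) · ⁅g, h⁆` in any group. [folklore] -/
private theorem commutatorElement_mul_left_eq (g g' h : G) :
    ⁅g * g', h⁆ = g * ⁅g', h⁆ * g⁻¹ * ⁅g, h⁆ := by
  simp only [commutatorElement_def]
  group

/-- If every commutator of `G` is central ("class ≤ 2") then `⁅·, h⁆` is a homomorphism: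
`⁅g·g', h⁆ = ⁅g, h⁆ · ⁅g', h⁆`. [folklore] -/
private theorem commutatorElement_mul_left_of_central
    (hc : ∀ g h k : G, ⁅g, h⁆ * k = k * ⁅g, h⁆) (g g' h : G) :
    ⁅g * g', h⁆ = ⁅g, h⁆ * ⁅g', h⁆ := by
  rw [commutatorElement_mul_left_eq, ← hc g' h g, mul_inv_cancel_right, hc]

/-- Class two: `⁅g⁻¹, h⁆ = ⁅g, h⁆⁻¹`. [folklore] -/
private theorem commutatorElement_inv_left_of_central
    (hc : ∀ g h k : G, ⁅g, h⁆ * k = k * ⁅g, h⁆) (g h : G) :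
    ⁅g⁻¹, h⁆ = ⁅g, h⁆⁻¹ := by
  have h1 : ⁅g⁻¹ * g, h⁆ = ⁅g⁻¹, h⁆ * ⁅g, h⁆ := commutatorElement_mul_left_of_central hc _ _ _
  rw [inv_mul_cancel, commutatorElement_one_left] at h1
  exact eq_inv_of_mul_eq_one_left h1.symm

/-- Class two: `⁅g^m, h⁆ = ⁅g, h⁆^m` for `m ∈ ℕ`. [folklore] -/
private theorem commutatorElement_pow_left_of_central
    (hc : ∀ g h k : G, ⁅g, h⁆ * k = k * ⁅g, h⁆) (g h : G) (m : ℕ) :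
    ⁅g ^ m, h⁆ = ⁅g, h⁆ ^ m := by
  induction m with
  | zero => simp
  | succ m ih => rw [pow_succ, commutatorElement_mul_left_of_central hc, ih, pow_succ]

/-- Class two: `⁅g^m, h⁆ = ⁅g, h⁆^m` for `m ∈ ℤ`. [folklore] -/
private theorem commutatorElement_zpow_left_of_central
    (hc : ∀ g h k : G, ⁅g, h⁆ * k = k * ⁅g, h⁆) (g h : G) (m : ℤ) :
    ⁅g ^ m, h⁆ = ⁅g, h⁆ ^ m := by
  cases m with
  | ofNat m => simp [commutatorElement_pow_left_of_central hc]
  | negSucc m =>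
    rw [zpow_negSucc, zpow_negSucc, commutatorElement_inv_left_of_central hc,
      commutatorElement_pow_left_of_central hc]

/-- Class two: `⁅g, h^n⁆ = ⁅g, h⁆^n` for `n ∈ ℤ` (by `⁅g,h⁆⁻¹ = ⁅h,g⁆`). [folklore] -/
private theorem commutatorElement_zpow_right_of_central
    (hc : ∀ g h k : G, ⁅g, h⁆ * k = k * ⁅g, h⁆) (g h : G) (n : ℤ) :
    ⁅g, h ^ n⁆ = ⁅g, h⁆ ^ n := by
  rw [← inv_inj, commutatorElement_inv, commutatorElement_zpow_left_of_central hc,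
    ← commutatorElement_inv, inv_zpow]

/-- Class two: `⁅g^m, h^n⁆ = ⁅g, h⁆^(m·n)`. [folklore] -/
private theorem commutatorElement_zpow_zpow_of_central
    (hc : ∀ g h k : G, ⁅g, h⁆ * k = k * ⁅g, h⁆) (g h : G) (m n : ℤ) :
    ⁅g ^ m, h ^ n⁆ = ⁅g, h⁆ ^ (m * n) := by
  rw [commutatorElement_zpow_left_of_central hc, commutatorElement_zpow_right_of_central hc,
    ← zpow_mul, mul_comm]

/-- `⁅x, y⁆ · y · x = x · y` in any group. [folklore] -/
private theorem commutatorElement_mul_mul_eq (x y : G) : ⁅x, y⁆ * y * x = x * y := by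
  simp only [commutatorElement_def]
  group

/-- In a group with `⁅⁅G,G⁆,G⁆ = 1` every commutator is central. [folklore] -/
private theorem commutatorElement_central_of_eq_bot
    (hG : ⁅⁅(⊤ : Subgroup G), (⊤ : Subgroup G)⁆, (⊤ : Subgroup G)⁆ = ⊥) (g h k : G) :
    ⁅g, h⁆ * k = k * ⁅g, h⁆ := by
  rw [Subgroup.commutator_eq_bot_iff_le_centralizer] at hG
  have h1 : ⁅g, h⁆ ∈ ⁅(⊤ : Subgroup G), (⊤ : Subgroup G)⁆ :=
    Subgroup.commutator_mem_commutator (Subgroup.mem_top g) (Subgroup.mem_top h)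
  exact ((Subgroup.mem_centralizer_iff.mp (hG h1)) k (Subgroup.mem_top k)).symm

/-- **The class-two multiplication law.** If all commutators of `G` are central, then for `a, b ∈ G`,
`c := ⁅a, b⁆`, the normal forms multiply as in `Heis ℤ`:
`(a^x b^y c^(z−xy)) · (a^x' b^y' c^(z'−x'y')) = a^(x+x') b^(y+y') c^((z+z'+xy') − (x+x')(y+y'))`. [folklore] -/
private theorem normalForm_mul (hc : ∀ g h k : G, ⁅g, h⁆ * k = k * ⁅g, h⁆) (a b : G) (g h : Heis ℤ) :
    (a ^ g.x * b ^ g.y * ⁅a, b⁆ ^ (g.z - g.x * g.y)) * (a ^ h.x * b ^ h.y * ⁅a, b⁆ ^ (h.z - h.x * h.y)) =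
      a ^ (g.x + h.x) * b ^ (g.y + h.y) * ⁅a, b⁆ ^ ((g.z + h.z + g.x * h.y) - (g.x + h.x) * (g.y + h.y)) := by
  set c : G := ⁅a, b⁆ with hcdef
  -- powers of the central commutator `c = ⁅a,b⁆` are central
  have hcz : ∀ (k : ℤ) (t : G), t * c ^ k = c ^ k * t := by
    intro k t
    have hmem : c ∈ Subgroup.center G := by
      rw [Subgroup.mem_center_iff]
      intro u
      exact (hc a b u).symm
    exact (Subgroup.mem_center_iff.mp (Subgroup.zpow_mem _ hmem k)) t
  -- the swap `b^y a^x' = c^(−(y·x')) (a^x' b^y)`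
  have hswap : b ^ g.y * a ^ h.x = c ^ (-(g.y * h.x)) * (a ^ h.x * b ^ g.y) := by
    rw [← commutatorElement_mul_mul_eq (b ^ g.y) (a ^ h.x), commutatorElement_zpow_zpow_of_central hc,
      ← commutatorElement_inv a b, inv_zpow, ← zpow_neg, mul_assoc]
  -- Step 1: bring the two normal forms next to each other, `c`-powers to the right.
  have e1 : a ^ g.x * b ^ g.y * c ^ (g.z - g.x * g.y) * (a ^ h.x * b ^ h.y * c ^ (h.z - h.x * h.y)) =
      a ^ g.x * (b ^ g.y * a ^ h.x) * b ^ h.y * (c ^ (h.z - h.x * h.y) * c ^ (g.z - g.x * g.y)) := by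
    calc a ^ g.x * b ^ g.y * c ^ (g.z - g.x * g.y) * (a ^ h.x * b ^ h.y * c ^ (h.z - h.x * h.y))
        = a ^ g.x * b ^ g.y * (c ^ (g.z - g.x * g.y) * (a ^ h.x * b ^ h.y * c ^ (h.z - h.x * h.y))) := by
          simp only [mul_assoc]
      _ = a ^ g.x * b ^ g.y * ((a ^ h.x * b ^ h.y * c ^ (h.z - h.x * h.y)) * c ^ (g.z - g.x * g.y)) := by
          rw [← hcz (g.z - g.x * g.y) (a ^ h.x * b ^ h.y * c ^ (h.z - h.x * h.y))]
      _ = a ^ g.x * (b ^ g.y * a ^ h.x) * b ^ h.y * (c ^ (h.z - h.x * h.y) * c ^ (g.z - g.x * g.y)) := by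
          simp only [mul_assoc]
  -- Step 2: swap the middle and move the new `c`-power to the far left.
  have e2 : a ^ g.x * (b ^ g.y * a ^ h.x) * b ^ h.y * (c ^ (h.z - h.x * h.y) * c ^ (g.z - g.x * g.y)) =
      c ^ (-(g.y * h.x)) * (a ^ (g.x + h.x) * b ^ (g.y + h.y) *
        c ^ ((h.z - h.x * h.y) + (g.z - g.x * g.y))) := by
    rw [hswap, zpow_add a, zpow_add b, zpow_add c]
    calc a ^ g.x * (c ^ (-(g.y * h.x)) * (a ^ h.x * b ^ g.y)) * b ^ h.y *
          (c ^ (h.z - h.x * h.y) * c ^ (g.z - g.x * g.y))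
        = (a ^ g.x * c ^ (-(g.y * h.x))) * (a ^ h.x * b ^ g.y * b ^ h.y *
          (c ^ (h.z - h.x * h.y) * c ^ (g.z - g.x * g.y))) := by simp only [mul_assoc]
      _ = (c ^ (-(g.y * h.x)) * a ^ g.x) * (a ^ h.x * b ^ g.y * b ^ h.y *
          (c ^ (h.z - h.x * h.y) * c ^ (g.z - g.x * g.y))) := by rw [hcz]
      _ = c ^ (-(g.y * h.x)) * (a ^ g.x * a ^ h.x * (b ^ g.y * b ^ h.y) *
          (c ^ (h.z - h.x * h.y) * c ^ (g.z - g.x * g.y))) := by simp only [mul_assoc]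
  -- Step 3: move it back to the right and collect exponents.
  rw [e1, e2, ← hcz (-(g.y * h.x)), mul_assoc _ (c ^ _) (c ^ _), ← zpow_add c]
  congr 2
  ring

/-- **Universal property of `Heis ℤ` among groups of class ≤ 2.** If all commutators of `G` are central,
then for any `a, b ∈ G` there is a homomorphism `ψ : Heis ℤ → G` with `ψ(1,0,0) = a`, `ψ(0,1,0) = b` — namely
`(x,y,z) ↦ a^x b^y ⁅a,b⁆^(z−xy)` (so `ψ(0,0,1) = ⁅a,b⁆`): the algebraic content of "`Δ^Θ_X := Δ_X/[Δ_X,[Δ_X,Δ_X]]`" at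
the discrete level (p. 12). [cite: MochizukiEtTh2009, §1 p.12] -/
theorem Heis.exists_hom_of_commutator_central (hc : ∀ g h k : G, ⁅g, h⁆ * k = k * ⁅g, h⁆) (a b : G) :
    ∃ ψ : Heis ℤ →* G, (∀ g : Heis ℤ, ψ g = a ^ g.x * b ^ g.y * ⁅a, b⁆ ^ (g.z - g.x * g.y)) ∧
      ψ ⟨1, 0, 0⟩ = a ∧ ψ ⟨0, 1, 0⟩ = b ∧ ψ ⟨0, 0, 1⟩ = ⁅a, b⁆ := by
  refine ⟨MonoidHom.mk' (fun g : Heis ℤ => a ^ g.x * b ^ g.y * ⁅a, b⁆ ^ (g.z - g.x * g.y))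
    (fun g h => ?_), fun g => rfl, by simp, by simp, by simp⟩
  show a ^ (g * h).x * b ^ (g * h).y * ⁅a, b⁆ ^ ((g * h).z - (g * h).x * (g * h).y) = _
  rw [Heis.mul_x, Heis.mul_y, Heis.mul_z, normalForm_mul hc]

end ClassTwo

/-! ### The kernel of `F₂ ↠ Heis ℤ` -/

/-- `[[F₂,F₂],F₂]` is normal. [folklore] -/
private theorem commutator_commutator_top_normal :
    (⁅⁅(⊤ : Subgroup F₂), (⊤ : Subgroup F₂)⁆, (⊤ : Subgroup F₂)⁆).Normal := by
  infer_instance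

/-- The quotient of any group by `[[G,G],G]` has central commutators. [folklore] -/
private theorem commutatorElement_central_quotient {H : Type*} [Group H]
    (N : Subgroup H) [N.Normal] (hN : ⁅⁅(⊤ : Subgroup H), (⊤ : Subgroup H)⁆, (⊤ : Subgroup H)⁆ ≤ N)
    (g h k : H ⧸ N) : ⁅g, h⁆ * k = k * ⁅g, h⁆ := by
  apply commutatorElement_central_of_eq_bot
  have htop : (⊤ : Subgroup (H ⧸ N)) = (⊤ : Subgroup H).map (QuotientGroup.mk' N) :=
    (Subgroup.map_top_of_surjective _ (QuotientGroup.mk'_surjective N)).symm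
  rw [htop, ← Subgroup.map_commutator, ← Subgroup.map_commutator, eq_bot_iff]
  rintro _ ⟨x, hx, rfl⟩
  rw [Subgroup.mem_bot, QuotientGroup.mk'_apply, QuotientGroup.eq_one_iff]
  exact hN hx

/-- **`Ker(F₂ ↠ Heis ℤ) = [[F₂,F₂],F₂]`**: the integral Heisenberg group is the free class-two nilpotent
group on the two generators `a ↦ (1,0,0)`, `b ↦ (0,1,0)` — the discrete shadow of
"`Δ^Θ_X := Δ_X/[Δ_X,[Δ_X,Δ_X]]`" (p. 12) is EXACTLY `Heis ℤ` (with `heisHom_surjective`). Proof: the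
quotient `Q := F₂/[[F₂,F₂],F₂]` has central commutators, so the universal property gives
`ψ : Heis ℤ → Q` with `ψ ∘ heisHom = (F₂ ↠ Q)` on the generators, hence everywhere.
[cite: MochizukiEtTh2009, §1 p.12] -/
theorem ker_heisHom_eq_commutator_commutator :
    heisHom.ker = ⁅⁅(⊤ : Subgroup F₂), (⊤ : Subgroup F₂)⁆, (⊤ : Subgroup F₂)⁆ := by
  refine le_antisymm ?_ (Heis.commutator_commutator_le_ker heisHom)
  set N : Subgroup F₂ := ⁅⁅(⊤ : Subgroup F₂), (⊤ : Subgroup F₂)⁆, (⊤ : Subgroup F₂)⁆ with hNdef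
  haveI : N.Normal := commutator_commutator_top_normal
  obtain ⟨ψ, -, hψa, hψb, -⟩ := Heis.exists_hom_of_commutator_central
    (commutatorElement_central_quotient N le_rfl)
    (QuotientGroup.mk' N (FreeGroup.of 0)) (QuotientGroup.mk' N (FreeGroup.of 1))
  -- `ψ ∘ heisHom = mk'` : two homomorphisms out of the free group agreeing on the generators
  have hcomp : ψ.comp heisHom = QuotientGroup.mk' N := by
    ext i
    fin_cases i
    · simpa using hψa
    · simpa using hψb
  intro g hg
  rw [MonoidHom.mem_ker] at hg
  have h1 : QuotientGroup.mk' N g = 1 := by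
    rw [← hcomp, MonoidHom.comp_apply, hg, map_one]
  rwa [QuotientGroup.mk'_apply, QuotientGroup.eq_one_iff] at h1

/-- `F₂/[[F₂,F₂],F₂] ≅ Heis ℤ`: the map induced by `heisHom` on the class-two quotient is bijective.
[cite: MochizukiEtTh2009, §1 p.12] -/
theorem bijective_lift_heisHom :
    Function.Bijective (QuotientGroup.lift (⁅⁅(⊤ : Subgroup F₂), (⊤ : Subgroup F₂)⁆, (⊤ : Subgroup F₂)⁆)
      heisHom (Heis.commutator_commutator_le_ker heisHom)) := by
  constructor
  · rw [← MonoidHom.ker_eq_bot_iff, eq_bot_iff]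
    intro x hx
    obtain ⟨g, rfl⟩ := QuotientGroup.mk_surjective x
    rw [MonoidHom.mem_ker, QuotientGroup.lift_mk] at hx
    rw [Subgroup.mem_bot, QuotientGroup.eq_one_iff, ← ker_heisHom_eq_commutator_commutator]
    exact hx
  · intro h
    obtain ⟨g, rfl⟩ := heisHom_surjective h
    exact ⟨QuotientGroup.mk g, QuotientGroup.lift_mk _ _ g⟩

/-- An element of `F₂` dying in EVERY finite Heisenberg group `Heis (ℤ/M)`, `M ≥ 1`, lies in
`[[F₂,F₂],F₂]` (combine with `Heis.eq_one_of_forall_map_eq_one`). [cite: MochizukiEtTh2009, §1 p.12] -/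
theorem mem_commutator_commutator_of_forall_map_heisHom_eq_one (g : F₂)
    (h : ∀ M : ℕ, 0 < M → Heis.map (Int.castRingHom (ZMod M)) (heisHom g) = 1) :
    g ∈ ⁅⁅(⊤ : Subgroup F₂), (⊤ : Subgroup F₂)⁆, (⊤ : Subgroup F₂)⁆ := by
  rw [← ker_heisHom_eq_commutator_commutator, MonoidHom.mem_ker]
  exact Heis.eq_one_of_forall_map_eq_one _ h

end Literature.AnabelianGeometry.EtaleTheta.SettingModel
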